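import Mathlib.MeasureTheory.Measure.Lebesgue.VolumeOfBalls
import Mathlib.MeasureTheory.Measure.Haar.InnerProductSpace
import HarnessLib

/-!
# Lattice points of `ℤ²` in a disc: `≥ π·(ρ − 2)²`

HONEST FRAMING. Part of the venture `Summits/Ventures/Crystal3D` (cell `crystal3d-full`).
Elementary geometry of numbers (companion of `TriangularDiscCount.lean`); nothing about packings.

**Theorem** (`square_disc_count`). For every centre `(c₀, c₁)`, every `ρ ≥ 2` and every finite
`T ⊆ ℤ²` containing all `(i, j)` with `(i − c₀)² + (j − c₁)² ≤ ρ²`: `π (ρ − 2)² ≤ #T`.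
Proof: the unit squares `[i, i+1) × [j, j+1)`, `(i, j) ∈ T`, cover the disc of radius `ρ − 2`
about `c` (the corner `(⌊y₀⌋, ⌊y₁⌋)` of the square containing `y` is within `√2 < 2` of `y`), whose
area is `π(ρ − 2)²` (`EuclideanSpace.volume_ball_fin_two`).  Used for the square `(100)` layers of
the fcc packing (`StickySpheres/FccCubeFacetNoGain.lean`).

WHAT THIS IS NOT: not the Gauss circle problem (no upper bound, crude `O(ρ)` error).
-/

noncomputable section

namespace Summit.Ventures.Crystal3D

open MeasureTheory Set Finset

/-- **Square-lattice disc count.** If `T ⊆ ℤ²` contains every `(i, j)` with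
`(i − c₀)² + (j − c₁)² ≤ ρ²` and `2 ≤ ρ`, then `π (ρ − 2)² ≤ #T`. -/
theorem square_disc_count (c₀ c₁ ρ : ℝ) (hρ : 2 ≤ ρ) (T : Finset (ℤ × ℤ))
    (hT : ∀ i j : ℤ, ((i : ℝ) - c₀) ^ 2 + ((j : ℝ) - c₁) ^ 2 ≤ ρ ^ 2 → (i, j) ∈ T) :
    Real.pi * (ρ - 2) ^ 2 ≤ (T.card : ℝ) := by
  classical
  -- unit boxes
  set Box : ℤ × ℤ → Set (Fin 2 → ℝ) := fun p =>
    Set.pi Set.univ fun m : Fin 2 =>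
      Ico ((![(p.1 : ℝ), (p.2 : ℝ)] : Fin 2 → ℝ) m) ((![(p.1 : ℝ), (p.2 : ℝ)] : Fin 2 → ℝ) m + 1)
    with hBox
  have hBoxvol : ∀ p, volume (Box p) = 1 := by
    intro p
    rw [hBox]
    simp only
    rw [Real.volume_pi_Ico]
    simp
  -- the disc of radius `ρ - 2` about `c`
  set c : Fin 2 → ℝ := ![c₀, c₁] with hc
  set D : Set (Fin 2 → ℝ) :=
    (WithLp.toLp 2 : (Fin 2 → ℝ) → EuclideanSpace ℝ (Fin 2)) ⁻¹'
      Metric.ball (WithLp.toLp 2 c) (ρ - 2) with hD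
  have hDvol : volume D = ENNReal.ofReal (ρ - 2) ^ 2 * ENNReal.ofReal Real.pi := by
    rw [hD, (PiLp.volume_preserving_toLp (Fin 2)).measure_preimage
      measurableSet_ball.nullMeasurableSet, EuclideanSpace.volume_ball_fin_two]
  have hdist : ∀ a b : Fin 2 → ℝ,
      dist (WithLp.toLp 2 a : EuclideanSpace ℝ (Fin 2)) (WithLp.toLp 2 b) =
        Real.sqrt ((a 0 - b 0) ^ 2 + (a 1 - b 1) ^ 2) := by
    intro a b
    rw [EuclideanSpace.dist_eq, Fin.sum_univ_two]
    simp only [Real.dist_eq, sq_abs]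
  -- covering
  have hcover : D ⊆ ⋃ p ∈ T, Box p := by
    intro y hy
    rw [hD, Set.mem_preimage, Metric.mem_ball] at hy
    set i : ℤ := ⌊y 0⌋ with hi
    set j : ℤ := ⌊y 1⌋ with hj
    have hyi : (i : ℝ) ≤ y 0 ∧ y 0 < i + 1 := ⟨Int.floor_le _, Int.lt_floor_add_one _⟩
    have hyj : (j : ℝ) ≤ y 1 ∧ y 1 < j + 1 := ⟨Int.floor_le _, Int.lt_floor_add_one _⟩
    rw [Set.mem_iUnion₂]
    refine ⟨(i, j), ?_, ?_⟩
    · apply hT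
      set q : Fin 2 → ℝ := ![(i : ℝ), (j : ℝ)] with hq
      have hq0 : q 0 = (i : ℝ) := by simp [hq]
      have hq1 : q 1 = (j : ℝ) := by simp [hq]
      have hc0 : c 0 = c₀ := by simp [hc]
      have hc1 : c 1 = c₁ := by simp [hc]
      have hqy : (q 0 - y 0) ^ 2 + (q 1 - y 1) ^ 2 ≤ 4 := by
        rw [hq0, hq1]; nlinarith [hyi.1, hyi.2, hyj.1, hyj.2]
      have hdqy : dist (WithLp.toLp 2 q : EuclideanSpace ℝ (Fin 2)) (WithLp.toLp 2 y) ≤ 2 := by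
        rw [hdist]
        calc Real.sqrt ((q 0 - y 0) ^ 2 + (q 1 - y 1) ^ 2) ≤ Real.sqrt 4 :=
              Real.sqrt_le_sqrt hqy
          _ = 2 := by
              rw [show (4 : ℝ) = 2 ^ 2 by norm_num, Real.sqrt_sq (by norm_num)]
      have hdqc : dist (WithLp.toLp 2 q : EuclideanSpace ℝ (Fin 2)) (WithLp.toLp 2 c) ≤ ρ := by
        have := dist_triangle (WithLp.toLp 2 q : EuclideanSpace ℝ (Fin 2)) (WithLp.toLp 2 y)
          (WithLp.toLp 2 c)
        linarith
      rw [hdist, hq0, hq1, hc0, hc1] at hdqc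
      have h0 : 0 ≤ ((i : ℝ) - c₀) ^ 2 + ((j : ℝ) - c₁) ^ 2 := by positivity
      nlinarith [Real.sq_sqrt h0, Real.sqrt_nonneg (((i : ℝ) - c₀) ^ 2 + ((j : ℝ) - c₁) ^ 2)]
    · rw [hBox, Set.mem_pi]
      intro m _
      fin_cases m
      · simpa using hyi
      · simpa using hyj
  -- measure comparison
  have hle : volume D ≤ (T.card : ENNReal) * 1 := by
    calc volume D ≤ volume (⋃ p ∈ T, Box p) := measure_mono hcover
      _ ≤ ∑ p ∈ T, volume (Box p) := measure_biUnion_finset_le T _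
      _ = ∑ p ∈ T, (1 : ENNReal) := sum_congr rfl fun p _ => hBoxvol p
      _ = (T.card : ENNReal) * 1 := by rw [sum_const, nsmul_eq_mul]
  rw [hDvol, mul_one] at hle
  have hρ2 : 0 ≤ ρ - 2 := by linarith
  have hle' : ENNReal.ofReal ((ρ - 2) ^ 2 * Real.pi) ≤ ENNReal.ofReal (T.card : ℝ) := by
    rw [ENNReal.ofReal_mul (sq_nonneg _), ENNReal.ofReal_pow hρ2, ENNReal.ofReal_natCast]
    exact hle
  have hreal := (ENNReal.ofReal_le_ofReal_iff (by positivity)).1 hle'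
  linarith

end Summit.Ventures.Crystal3D

end
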